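import Mathlib
import HarnessLib
import Summits.HodgeConjecture.HodgeConjecture.Theses.KleimanBFSeeds
import Summits.HodgeConjecture.HodgeConjecture.Theorems.Ring2SemiregularRepresentativesVHC
import Summits.HodgeConjecture.HodgeConjecture.Theorems.KleimanBFSeedsKleimanChernCharacterOnBettiOfNonempty
import Literature.AlgebraicGeometry.KTheory.ChernCharacterPresentsAlgebraicClasses

/-!
# `KleimanChernCharacterOnBetti` (stmt-HodgeConjecture-26526) versus the shared construction item
# `ChernCharacterOnBetti` (stmt-HodgeConjecture-19780), BY NAME

HONEST FRAMING: a bookkeeping HELPER for the construction crux K-C⁺ `KleimanChernCharacterOnBetti` of route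
`KleimanBFSeeds` (stmt-HodgeConjecture-26526, registered skeleton `Cruxes/KleimanChernCharacterOnBetti/Lines/birth.lean`,
one open stub `stub_virtualComplements`). It constructs NO Chern character and proves nothing toward K-C⁺, K2,
rung H2, HC_AV, HC_CM or HC. What it records, kernel-checked and with BOTH ledger items' declarations verbatim:

* `chernCharacterOnBetti_of_kleimanChernCharacterOnBetti` — K-C⁺ ⟹ K-C unconditionally: the route's crux
  `Theses.KleimanBFSeeds.KleimanChernCharacterOnBetti` (`∃ C, C.KleimanChernNormalForm`) implies the shared item
  `Ring2.SemiregularRepresentatives.ChernCharacterOnBetti` (`Nonempty ChernCharacterBetti`, stmt-HodgeConjecture-19780,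
  wanted by VHCAbelianSchemesRoad / FirstOrderSemiregularSeeds / TensorMonadSeeds / EightfoldTwistedSheafSeeds);
* `kleimanChernCharacterOnBetti_of_chernCharacterOnBetti` — K-C ⟹ K-C⁺ under Fulton's presentation fact
  `KTheory.Fulton1998_chernCharacter_presentsAlgebraicClasses` (the landed reduction
  `kleimanChernCharacterOnBetti_of_nonempty_chernCharacterBetti`, p793556, restated over the item's declaration);
* `kleimanChernCharacterOnBetti_iff_chernCharacterOnBetti` — hence, given that one named Literature fact, the two
  ledger items are EQUIVALENT by name: 26526 is exactly the construction debt 19780 (director req-138 (b):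
  "26526 = 19780 + one citation"), which is what a planner needs to bank 26526 `aside` / dedup it onto 19780.

References: [Fulton1998] Example 15.2.16 (b), Example 15.3.2, §15.1; the tree files
`Theorems/Ring2SemiregularRepresentativesVHC.lean` (decl of item 19780) and
`Theorems/KleimanBFSeedsKleimanChernCharacterOnBettiOfNonempty.lean` (p793556).
-/

-- every declaration of this problem lives in `Summit.HodgeConjecture.HodgeConjecture.…` (summit = sub-problem)
set_option linter.dupNamespace false

noncomputable section

namespace Summit.HodgeConjecture.HodgeConjecture.Theorems

open Literature.AlgebraicGeometry.HodgeTheory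

/-- **K-C⁺ ⟹ K-C (unconditional, by name)**: a Chern character on complex Betti cohomology with Kleiman's normal
form is in particular a Chern character on complex Betti cohomology — item stmt-HodgeConjecture-26526 implies the
shared construction item stmt-HodgeConjecture-19780. [cite: Fulton1998, §15.1 and Example 15.3.2] -/
theorem chernCharacterOnBetti_of_kleimanChernCharacterOnBetti
    (h : Summit.HodgeConjecture.HodgeConjecture.Theses.KleimanBFSeeds.KleimanChernCharacterOnBetti) :
    Summit.HodgeConjecture.HodgeConjecture.Ring2.SemiregularRepresentatives.ChernCharacterOnBetti := by
  obtain ⟨C, -⟩ := h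
  exact ⟨C⟩

/-- **K-C ⟹ K-C⁺ under Fulton's presentation fact (by name)**: the shared item stmt-HodgeConjecture-19780 and
`KTheory.Fulton1998_chernCharacter_presentsAlgebraicClasses` (Fulton Ex. 15.2.16 (b) + Serre) give item
stmt-HodgeConjecture-26526 — the landed reduction p793556 read over the declaration of item 19780.
[cite: Fulton1998, Example 15.2.16 (b) and Example 15.3.2] -/
theorem kleimanChernCharacterOnBetti_of_chernCharacterOnBetti
    (hCC : Summit.HodgeConjecture.HodgeConjecture.Ring2.SemiregularRepresentatives.ChernCharacterOnBetti)
    (hF : Literature.AlgebraicGeometry.KTheory.Fulton1998_chernCharacter_presentsAlgebraicClasses) :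
    Summit.HodgeConjecture.HodgeConjecture.Theses.KleimanBFSeeds.KleimanChernCharacterOnBetti :=
  kleimanChernCharacterOnBetti_of_nonempty_chernCharacterBetti hCC hF

/-- **26526 ⟺ 19780 given Fulton's presentation fact (by name)**: under
`KTheory.Fulton1998_chernCharacter_presentsAlgebraicClasses` the route's construction crux
`KleimanChernCharacterOnBetti` and the shared construction item `ChernCharacterOnBetti` are equivalent.
[cite: Fulton1998, Example 15.2.16 (b) and Example 15.3.2] -/
theorem kleimanChernCharacterOnBetti_iff_chernCharacterOnBetti
    (hF : Literature.AlgebraicGeometry.KTheory.Fulton1998_chernCharacter_presentsAlgebraicClasses) :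
    Summit.HodgeConjecture.HodgeConjecture.Theses.KleimanBFSeeds.KleimanChernCharacterOnBetti ↔
      Summit.HodgeConjecture.HodgeConjecture.Ring2.SemiregularRepresentatives.ChernCharacterOnBetti :=
  ⟨chernCharacterOnBetti_of_kleimanChernCharacterOnBetti,
    fun hCC => kleimanChernCharacterOnBetti_of_chernCharacterOnBetti hCC hF⟩

end Summit.HodgeConjecture.HodgeConjecture.Theorems

end
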